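import Summits.AtomisticToContinuum.Crystallization.Theorems.ExcessDecayLiouvilleNextConstantFresh

/-!
# Route `ExcessDecayLiouville`: the next mass constant of the chain — propagated masses and budgets (pure arithmetic)

Harmonic-replacement architecture for item `ExcessDecay` (stmt-AtomisticToContinuum-9334), nonlinear half.
Continuation of `ExcessDecayLiouvilleNextConstantFresh`: on the PROPAGATED range `X ≥ σ²` the new masses are
`≤ 2·(old) + 2·(increment)` (`propagated_mass_le`), and `propagated_le` shows this is below `32 (L¹⁰γ)² X⁶`;
`fresh_total_le` packages the fresh range; `potU_step`, `potV_step`, `sAgg_le_of_pot` propagate the two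
history-free budget potentials of the chain and extract the slope scale of the current step.
All `[folklore]`; pure real-variable inequalities, nothing here closes an item.
-/

namespace Summit.AtomisticToContinuum.Crystallization.Theorems.ExcessDecayLiouville

/-- Floor monomials at a scale `σ ≤ σ₀` against the aggregate floor `F`. [folklore] -/
theorem floor_monomials_le {σ σ₀ Φ ν Du r : ℝ} (hσ1 : 1 ≤ σ) (hσ₀ : σ ≤ σ₀) (hr0 : 0 < r) :
    σ ^ 4 * Φ ^ 2 + Du ^ 2 / (σ ^ 2 * r ^ 4) + σ ^ 4 * ν ^ 2 ≤
      σ ^ 2 * (σ₀ ^ 2 * Φ ^ 2 + Φ ^ 2 + σ₀ ^ 6 * ν ^ 2 + σ₀ ^ 2 * ν ^ 2 + ν ^ 2 + Du ^ 2 / r ^ 4) ∧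
    σ ^ 8 * Φ ^ 2 + σ ^ 4 * Du ^ 2 / r ^ 4 ≤
      σ ^ 6 * (σ₀ ^ 2 * Φ ^ 2 + Φ ^ 2 + σ₀ ^ 6 * ν ^ 2 + σ₀ ^ 2 * ν ^ 2 + ν ^ 2 + Du ^ 2 / r ^ 4) := by
  have hσ0 : 0 < σ := by linarith
  have hσ2le : σ ^ 2 ≤ σ₀ ^ 2 := pow_le_pow_left₀ hσ0.le hσ₀ 2
  have hσ₀0 : 0 ≤ σ₀ := hσ0.le.trans hσ₀
  have hD1 : Du ^ 2 / (σ ^ 2 * r ^ 4) ≤ Du ^ 2 / r ^ 4 := by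
    refine div_le_div_of_nonneg_left (sq_nonneg _) (by positivity) ?_
    exact le_mul_of_one_le_left (pow_nonneg hr0.le 4) (one_le_pow₀ hσ1)
  constructor
  · have h1 : σ ^ 4 * Φ ^ 2 ≤ σ ^ 2 * (σ₀ ^ 2 * Φ ^ 2) := by
      rw [show σ ^ 4 * Φ ^ 2 = σ ^ 2 * (σ ^ 2 * Φ ^ 2) by ring]
      exact mul_le_mul_of_nonneg_left (mul_le_mul_of_nonneg_right hσ2le (sq_nonneg _)) (by positivity)
    have h2 : Du ^ 2 / (σ ^ 2 * r ^ 4) ≤ σ ^ 2 * (Du ^ 2 / r ^ 4) :=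
      hD1.trans (le_mul_of_one_le_left (by positivity) (one_le_pow₀ hσ1))
    have h3 : σ ^ 4 * ν ^ 2 ≤ σ ^ 2 * (σ₀ ^ 2 * ν ^ 2) := by
      rw [show σ ^ 4 * ν ^ 2 = σ ^ 2 * (σ ^ 2 * ν ^ 2) by ring]
      exact mul_le_mul_of_nonneg_left (mul_le_mul_of_nonneg_right hσ2le (sq_nonneg _)) (by positivity)
    have h4 : 0 ≤ σ ^ 2 * (Φ ^ 2 + σ₀ ^ 6 * ν ^ 2 + ν ^ 2) := by positivity
    have e : σ ^ 2 * (σ₀ ^ 2 * Φ ^ 2 + Φ ^ 2 + σ₀ ^ 6 * ν ^ 2 + σ₀ ^ 2 * ν ^ 2 + ν ^ 2 + Du ^ 2 / r ^ 4) =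
        σ ^ 2 * (σ₀ ^ 2 * Φ ^ 2) + σ ^ 2 * (Du ^ 2 / r ^ 4) + σ ^ 2 * (σ₀ ^ 2 * ν ^ 2) + σ ^ 2 * (Φ ^ 2 + σ₀ ^ 6 * ν ^ 2 + ν ^ 2) := by
      ring
    rw [e]; linarith
  · have h1 : σ ^ 8 * Φ ^ 2 ≤ σ ^ 6 * (σ₀ ^ 2 * Φ ^ 2) := by
      rw [show σ ^ 8 * Φ ^ 2 = σ ^ 6 * (σ ^ 2 * Φ ^ 2) by ring]
      exact mul_le_mul_of_nonneg_left (mul_le_mul_of_nonneg_right hσ2le (sq_nonneg _)) (by positivity)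
    have h2 : σ ^ 4 * Du ^ 2 / r ^ 4 ≤ σ ^ 6 * (Du ^ 2 / r ^ 4) := by
      rw [mul_div_assoc]
      exact mul_le_mul_of_nonneg_right (pow_le_pow_right₀ hσ1 (by norm_num)) (by positivity)
    have h4 : 0 ≤ σ ^ 6 * (Φ ^ 2 + σ₀ ^ 6 * ν ^ 2 + σ₀ ^ 2 * ν ^ 2 + ν ^ 2) := by positivity
    have e : σ ^ 6 * (σ₀ ^ 2 * Φ ^ 2 + Φ ^ 2 + σ₀ ^ 6 * ν ^ 2 + σ₀ ^ 2 * ν ^ 2 + ν ^ 2 + Du ^ 2 / r ^ 4) =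
        σ ^ 6 * (σ₀ ^ 2 * Φ ^ 2) + σ ^ 6 * (Du ^ 2 / r ^ 4) + σ ^ 6 * (Φ ^ 2 + σ₀ ^ 6 * ν ^ 2 + σ₀ ^ 2 * ν ^ 2 + ν ^ 2) := by
      ring
    rw [e]; linarith

/-- The square of the slope aggregate. [folklore] -/
theorem slopeAgg_sq_le {σ γ Φ ν Du r : ℝ} (hσ0 : 0 < σ) (hr0 : 0 < r) :
    (γ * σ + σ ^ 2 * Φ + Du / (σ * r ^ 2) + σ ^ 2 * ν) ^ 2 ≤
      4 * (γ ^ 2 * σ ^ 2 + σ ^ 4 * Φ ^ 2 + Du ^ 2 / (σ ^ 2 * r ^ 4) + σ ^ 4 * ν ^ 2) := by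
  have h2 : (γ * σ + σ ^ 2 * Φ + Du / (σ * r ^ 2) + σ ^ 2 * ν) ^ 2 ≤ 4 * ((γ * σ) ^ 2 + (σ ^ 2 * Φ) ^ 2 + (Du / (σ * r ^ 2)) ^ 2 + (σ ^ 2 * ν) ^ 2) := by
    nlinarith only [sq_nonneg (γ * σ - σ ^ 2 * Φ), sq_nonneg (γ * σ - Du / (σ * r ^ 2)), sq_nonneg (γ * σ - σ ^ 2 * ν),
      sq_nonneg (σ ^ 2 * Φ - Du / (σ * r ^ 2)), sq_nonneg (σ ^ 2 * Φ - σ ^ 2 * ν), sq_nonneg (Du / (σ * r ^ 2) - σ ^ 2 * ν)]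
  have e : (γ * σ) ^ 2 + (σ ^ 2 * Φ) ^ 2 + (Du / (σ * r ^ 2)) ^ 2 + (σ ^ 2 * ν) ^ 2 =
      γ ^ 2 * σ ^ 2 + σ ^ 4 * Φ ^ 2 + Du ^ 2 / (σ ^ 2 * r ^ 4) + σ ^ 4 * ν ^ 2 := by
    field_simp
  rw [← e]; exact h2

/-- The square of the value aggregate. [folklore] -/
theorem valueAgg_sq_le {σ γ Φ Du r : ℝ} (hr0 : 0 < r) :
    (γ * σ ^ 3 + σ ^ 4 * Φ + σ ^ 2 * Du / r ^ 2) ^ 2 ≤ 3 * (γ ^ 2 * σ ^ 6 + σ ^ 8 * Φ ^ 2 + σ ^ 4 * Du ^ 2 / r ^ 4) := by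
  have h2 : (γ * σ ^ 3 + σ ^ 4 * Φ + σ ^ 2 * Du / r ^ 2) ^ 2 ≤ 3 * ((γ * σ ^ 3) ^ 2 + (σ ^ 4 * Φ) ^ 2 + (σ ^ 2 * Du / r ^ 2) ^ 2) := by
    nlinarith only [sq_nonneg (γ * σ ^ 3 - σ ^ 4 * Φ), sq_nonneg (γ * σ ^ 3 - σ ^ 2 * Du / r ^ 2), sq_nonneg (σ ^ 4 * Φ - σ ^ 2 * Du / r ^ 2)]
  have e : (γ * σ ^ 3) ^ 2 + (σ ^ 4 * Φ) ^ 2 + (σ ^ 2 * Du / r ^ 2) ^ 2 = γ ^ 2 * σ ^ 6 + σ ^ 8 * Φ ^ 2 + σ ^ 4 * Du ^ 2 / r ^ 4 := by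
    field_simp
  rw [← e]; exact h2

/-- **The slope increment against the next constant**: `(42/5) b² ≤ L²⁰ γ² σ²`. [folklore] -/
theorem incr_slope_sq_le {L σ σ₀ γ γ₀ Φ ν Du r bT : ℝ} (hL : 239000000 ≤ L) (hσm : L ^ 17 ≤ σ) (hσ₀ : σ ≤ σ₀)
    (hγ₀ : 0 ≤ γ₀) (hγ : γ₀ ≤ γ) (hr : 1 ≤ r)
    (hbT0 : 0 ≤ bT) (hbT : bT ≤ 12 * L ^ 8 * (γ * σ + σ ^ 2 * Φ + Du / (σ * r ^ 2) + σ ^ 2 * ν))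
    (hfloor : L ^ 114 * (σ₀ ^ 2 * Φ ^ 2 + Φ ^ 2 + σ₀ ^ 6 * ν ^ 2 + σ₀ ^ 2 * ν ^ 2 + ν ^ 2 + Du ^ 2 / r ^ 4) ≤ γ₀ ^ 2) :
    (42 / 5) * bT ^ 2 ≤ L ^ 20 * γ ^ 2 * σ ^ 2 := by
  have hL0 : 0 ≤ L := le_trans (by norm_num) hL
  have hL1 : 1 ≤ L := le_trans (by norm_num) hL
  have hσ1 : (1 : ℝ) ≤ σ := le_trans (one_le_pow₀ hL1) hσm
  have hσ0 : 0 < σ := by linarith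
  have hr0 : 0 < r := by linarith
  have hγ2 : γ₀ ^ 2 ≤ γ ^ 2 := pow_le_pow_left₀ hγ₀ hγ 2
  set F : ℝ := σ₀ ^ 2 * Φ ^ 2 + Φ ^ 2 + σ₀ ^ 6 * ν ^ 2 + σ₀ ^ 2 * ν ^ 2 + ν ^ 2 + Du ^ 2 / r ^ 4 with hF
  have hF0 : 0 ≤ F := by rw [hF]; positivity
  have hFγ : L ^ 114 * F ≤ γ ^ 2 := hfloor.trans hγ2
  have hS2 := slopeAgg_sq_le (γ := γ) (Φ := Φ) (ν := ν) (Du := Du) hσ0 hr0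
  obtain ⟨hfl1, -⟩ := floor_monomials_le (Φ := Φ) (ν := ν) (Du := Du) hσ1 hσ₀ hr0
  have h1 : bT ^ 2 ≤ 144 * L ^ 16 * (γ * σ + σ ^ 2 * Φ + Du / (σ * r ^ 2) + σ ^ 2 * ν) ^ 2 := by
    have := pow_le_pow_left₀ hbT0 hbT 2
    calc bT ^ 2 ≤ (12 * L ^ 8 * (γ * σ + σ ^ 2 * Φ + Du / (σ * r ^ 2) + σ ^ 2 * ν)) ^ 2 := this
      _ = _ := by ring
  have h2 : bT ^ 2 ≤ 576 * L ^ 16 * (γ ^ 2 * σ ^ 2) + 576 * L ^ 16 * (σ ^ 2 * F) := by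
    have h4 : 4 * (γ ^ 2 * σ ^ 2 + σ ^ 4 * Φ ^ 2 + Du ^ 2 / (σ ^ 2 * r ^ 4) + σ ^ 4 * ν ^ 2) ≤ 4 * (γ ^ 2 * σ ^ 2) + 4 * (σ ^ 2 * F) := by
      rw [hF]; linarith [hfl1]
    have := mul_le_mul_of_nonneg_left (hS2.trans h4) (by positivity : (0 : ℝ) ≤ 144 * L ^ 16)
    linarith
  have hL4 : (9677 : ℝ) ≤ L ^ 4 := le_trans (by norm_num) (le_trans hL (le_self_pow₀ hL1 (by norm_num)))
  have hc1 : (42 / 5) * (576 * L ^ 16 * (γ ^ 2 * σ ^ 2)) ≤ (1 / 2) * (L ^ 20 * γ ^ 2 * σ ^ 2) := by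
    have h0 : 0 ≤ L ^ 16 * (γ ^ 2 * σ ^ 2) := by positivity
    have := mul_le_mul_of_nonneg_right hL4 h0
    have e : L ^ 4 * (L ^ 16 * (γ ^ 2 * σ ^ 2)) = L ^ 20 * γ ^ 2 * σ ^ 2 := by ring
    rw [e] at this; linarith
  have hc2 : (42 / 5) * (576 * L ^ 16 * (σ ^ 2 * F)) ≤ (1 / 2) * (L ^ 20 * γ ^ 2 * σ ^ 2) := by
    have h98 : (9677 : ℝ) * L ^ 16 ≤ L ^ 114 := by
      have : (9677 : ℝ) ≤ L ^ 98 := le_trans (by norm_num) (le_trans hL (le_self_pow₀ hL1 (by norm_num)))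
      calc (9677 : ℝ) * L ^ 16 ≤ L ^ 98 * L ^ 16 := mul_le_mul_of_nonneg_right this (by positivity)
        _ = L ^ 114 := by ring
    have h1' : 9677 * L ^ 16 * F ≤ γ ^ 2 := (mul_le_mul_of_nonneg_right h98 hF0).trans hFγ
    have h2' : γ ^ 2 ≤ L ^ 20 * γ ^ 2 := le_mul_of_one_le_left (sq_nonneg _) (one_le_pow₀ hL1)
    have h3' := mul_le_mul_of_nonneg_right (h1'.trans h2') (sq_nonneg σ)
    have e : (42 / 5) * (576 * L ^ 16 * (σ ^ 2 * F)) = (24192 / 5) * (L ^ 16 * F * σ ^ 2) := by ring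
    have e' : 9677 * L ^ 16 * F * σ ^ 2 = 9677 * (L ^ 16 * F * σ ^ 2) := by ring
    have h0 : 0 ≤ L ^ 16 * F * σ ^ 2 := by positivity
    rw [e]; rw [e'] at h3'; linarith
  linarith [h2, hc1, hc2]

/-- **The value and shift increments against the next constant**: `16 (Vₐ + s)² ≤ L²⁰ γ² σ⁶`. [folklore] -/
theorem incr_value_sq_le {L σ σ₀ γ γ₀ Φ ν Du r Va s : ℝ} (hL : 239000000 ≤ L) (hσm : L ^ 17 ≤ σ) (hσ₀ : σ ≤ σ₀)
    (hγ₀ : 0 ≤ γ₀) (hγ : γ₀ ≤ γ) (hΦ : 0 ≤ Φ) (hν : 0 ≤ ν) (hDu : 0 ≤ Du) (hr : 1 ≤ r)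
    (hVa0 : 0 ≤ Va)
    (hVa : Va ≤ L ^ 8 * (γ * σ ^ 3 + σ ^ 4 * Φ + σ ^ 2 * Du / r ^ 2) + (66 / 5) * L ^ 8 * (γ * σ + σ ^ 2 * Φ + Du / (σ * r ^ 2) + σ ^ 2 * ν))
    (hs0 : 0 ≤ s) (hs : s ≤ L ^ 13 * (γ * σ + σ ^ 2 * Φ + Du / (σ * r ^ 2) + σ ^ 2 * ν))
    (hfloor : L ^ 114 * (σ₀ ^ 2 * Φ ^ 2 + Φ ^ 2 + σ₀ ^ 6 * ν ^ 2 + σ₀ ^ 2 * ν ^ 2 + ν ^ 2 + Du ^ 2 / r ^ 4) ≤ γ₀ ^ 2) :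
    16 * (Va + s) ^ 2 ≤ L ^ 20 * γ ^ 2 * σ ^ 6 := by
  have hL0 : 0 ≤ L := le_trans (by norm_num) hL
  have hL1 : 1 ≤ L := le_trans (by norm_num) hL
  have hσ1 : (1 : ℝ) ≤ σ := le_trans (one_le_pow₀ hL1) hσm
  have hσ0 : 0 < σ := by linarith
  have hr0 : 0 < r := by linarith
  have hγ0' : 0 ≤ γ := hγ₀.trans hγ
  have hγ2 : γ₀ ^ 2 ≤ γ ^ 2 := pow_le_pow_left₀ hγ₀ hγ 2
  set S : ℝ := γ * σ + σ ^ 2 * Φ + Du / (σ * r ^ 2) + σ ^ 2 * ν with hS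
  set F : ℝ := σ₀ ^ 2 * Φ ^ 2 + Φ ^ 2 + σ₀ ^ 6 * ν ^ 2 + σ₀ ^ 2 * ν ^ 2 + ν ^ 2 + Du ^ 2 / r ^ 4 with hF
  have hS0 : 0 ≤ S := by rw [hS]; positivity
  have hF0 : 0 ≤ F := by rw [hF]; positivity
  have hFγ : L ^ 114 * F ≤ γ ^ 2 := hfloor.trans hγ2
  have hS2 : S ^ 2 ≤ 4 * (γ ^ 2 * σ ^ 2 + σ ^ 4 * Φ ^ 2 + Du ^ 2 / (σ ^ 2 * r ^ 4) + σ ^ 4 * ν ^ 2) := by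
    rw [hS]; exact slopeAgg_sq_le hσ0 hr0
  have hV2 := valueAgg_sq_le (σ := σ) (γ := γ) (Φ := Φ) (Du := Du) hr0
  obtain ⟨hfl1, hfl2⟩ := floor_monomials_le (Φ := Φ) (ν := ν) (Du := Du) hσ1 hσ₀ hr0
  have hL5 : (66 / 5 : ℝ) * L ^ 8 ≤ L ^ 13 := by
    have : (66 / 5 : ℝ) ≤ L ^ 5 := le_trans (by norm_num) (le_trans hL (le_self_pow₀ hL1 (by norm_num)))
    calc (66 / 5 : ℝ) * L ^ 8 ≤ L ^ 5 * L ^ 8 := mul_le_mul_of_nonneg_right this (by positivity)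
      _ = L ^ 13 := by ring
  have hsum : Va + s ≤ L ^ 8 * (γ * σ ^ 3 + σ ^ 4 * Φ + σ ^ 2 * Du / r ^ 2) + 2 * L ^ 13 * S := by
    have := mul_le_mul_of_nonneg_right hL5 hS0
    linarith
  have hsq : (Va + s) ^ 2 ≤ 2 * (L ^ 16 * (γ * σ ^ 3 + σ ^ 4 * Φ + σ ^ 2 * Du / r ^ 2) ^ 2) + 8 * (L ^ 26 * S ^ 2) := by
    have h1 : (Va + s) ^ 2 ≤ (L ^ 8 * (γ * σ ^ 3 + σ ^ 4 * Φ + σ ^ 2 * Du / r ^ 2) + 2 * L ^ 13 * S) ^ 2 :=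
      pow_le_pow_left₀ (by positivity) hsum 2
    have h2 : (L ^ 8 * (γ * σ ^ 3 + σ ^ 4 * Φ + σ ^ 2 * Du / r ^ 2) + 2 * L ^ 13 * S) ^ 2 ≤
        2 * (L ^ 8 * (γ * σ ^ 3 + σ ^ 4 * Φ + σ ^ 2 * Du / r ^ 2)) ^ 2 + 2 * (2 * L ^ 13 * S) ^ 2 := by
      nlinarith only [sq_nonneg (L ^ 8 * (γ * σ ^ 3 + σ ^ 4 * Φ + σ ^ 2 * Du / r ^ 2) - 2 * L ^ 13 * S)]
    have e1 : 2 * (L ^ 8 * (γ * σ ^ 3 + σ ^ 4 * Φ + σ ^ 2 * Du / r ^ 2)) ^ 2 = 2 * (L ^ 16 * (γ * σ ^ 3 + σ ^ 4 * Φ + σ ^ 2 * Du / r ^ 2) ^ 2) := by ring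
    have e2 : 2 * (2 * L ^ 13 * S) ^ 2 = 8 * (L ^ 26 * S ^ 2) := by ring
    linarith
  have hV4 : 3 * (γ ^ 2 * σ ^ 6 + σ ^ 8 * Φ ^ 2 + σ ^ 4 * Du ^ 2 / r ^ 4) ≤ 3 * (γ ^ 2 * σ ^ 6) + 3 * (σ ^ 6 * F) := by
    rw [hF]; linarith [hfl2]
  have hS4 : 4 * (γ ^ 2 * σ ^ 2 + σ ^ 4 * Φ ^ 2 + Du ^ 2 / (σ ^ 2 * r ^ 4) + σ ^ 4 * ν ^ 2) ≤ 4 * (γ ^ 2 * σ ^ 2) + 4 * (σ ^ 2 * F) := by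
    rw [hF]; linarith [hfl1]
  have hV' := mul_le_mul_of_nonneg_left (hV2.trans hV4) (pow_nonneg hL0 16)
  have hS' := mul_le_mul_of_nonneg_left (hS2.trans hS4) (pow_nonneg hL0 26)
  have htot : 16 * (Va + s) ^ 2 ≤ 96 * (L ^ 16 * (γ ^ 2 * σ ^ 6)) + 96 * (L ^ 16 * (σ ^ 6 * F)) +
      512 * (L ^ 26 * (γ ^ 2 * σ ^ 2)) + 512 * (L ^ 26 * (σ ^ 2 * F)) := by linarith [hsq, hV', hS']
  -- the four pieces against L²⁰ γ² σ⁶ / 4 each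
  have hσ4 : 2048 * L ^ 26 * σ ^ 2 ≤ L ^ 20 * σ ^ 6 / 4 := by
    have h68 : L ^ 68 ≤ σ ^ 4 := by
      have := pow_le_pow_left₀ (by positivity) hσm 4
      rwa [← pow_mul] at this
    have h62 : (8192 : ℝ) ≤ L ^ 62 := le_trans (by norm_num) (le_trans hL (le_self_pow₀ hL1 (by norm_num)))
    have h1 : 8192 * L ^ 6 ≤ σ ^ 4 := by
      calc 8192 * L ^ 6 ≤ L ^ 62 * L ^ 6 := mul_le_mul_of_nonneg_right h62 (by positivity)
        _ = L ^ 68 := by ring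
        _ ≤ σ ^ 4 := h68
    have h2 := mul_le_mul_of_nonneg_left h1 (by positivity : (0 : ℝ) ≤ L ^ 20 * σ ^ 2)
    have e1 : L ^ 20 * σ ^ 2 * (8192 * L ^ 6) = 4 * (2048 * L ^ 26 * σ ^ 2) := by ring
    have e2 : L ^ 20 * σ ^ 2 * σ ^ 4 = L ^ 20 * σ ^ 6 := by ring
    rw [e1, e2] at h2; linarith
  have hp1 : 96 * (L ^ 16 * (γ ^ 2 * σ ^ 6)) ≤ L ^ 20 * γ ^ 2 * σ ^ 6 / 4 := by
    have hL4 : (384 : ℝ) ≤ L ^ 4 := le_trans (by norm_num) (le_trans hL (le_self_pow₀ hL1 (by norm_num)))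
    have h0 : 0 ≤ L ^ 16 * (γ ^ 2 * σ ^ 6) := by positivity
    have := mul_le_mul_of_nonneg_right hL4 h0
    have e : L ^ 4 * (L ^ 16 * (γ ^ 2 * σ ^ 6)) = L ^ 20 * γ ^ 2 * σ ^ 6 := by ring
    rw [e] at this; linarith
  have h00 : 0 ≤ L ^ 20 * γ ^ 2 * σ ^ 6 := by positivity
  have hp3 : 512 * (L ^ 26 * (γ ^ 2 * σ ^ 2)) ≤ L ^ 20 * γ ^ 2 * σ ^ 6 / 4 := by
    have := mul_le_mul_of_nonneg_left hσ4 (sq_nonneg γ)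
    have e1 : γ ^ 2 * (2048 * L ^ 26 * σ ^ 2) = 4 * (512 * (L ^ 26 * (γ ^ 2 * σ ^ 2))) := by ring
    have e2 : γ ^ 2 * (L ^ 20 * σ ^ 6 / 4) = L ^ 20 * γ ^ 2 * σ ^ 6 / 4 := by ring
    rw [e1, e2] at this; linarith
  have hFL : 1024 * L ^ 26 * F ≤ γ ^ 2 := by
    have h88 : (1024 : ℝ) ≤ L ^ 88 := le_trans (by norm_num) (le_trans hL (le_self_pow₀ hL1 (by norm_num)))
    have : 1024 * L ^ 26 ≤ L ^ 114 := by
      calc 1024 * L ^ 26 ≤ L ^ 88 * L ^ 26 := mul_le_mul_of_nonneg_right h88 (by positivity)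
        _ = L ^ 114 := by ring
    exact (mul_le_mul_of_nonneg_right this hF0).trans hFγ
  have hγσ : γ ^ 2 * σ ^ 6 ≤ L ^ 20 * γ ^ 2 * σ ^ 6 / 4 := by
    have hL20 : (4 : ℝ) ≤ L ^ 20 := le_trans (by norm_num) (le_trans hL (le_self_pow₀ hL1 (by norm_num)))
    have h0 : 0 ≤ γ ^ 2 * σ ^ 6 := by positivity
    have := mul_le_mul_of_nonneg_right hL20 h0
    linarith [this]
  have hFσ := mul_le_mul_of_nonneg_right hFL (by positivity : (0 : ℝ) ≤ σ ^ 6)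
  have hp2 : 96 * (L ^ 16 * (σ ^ 6 * F)) ≤ L ^ 20 * γ ^ 2 * σ ^ 6 / 4 := by
    have hL10 : L ^ 16 ≤ L ^ 26 := pow_le_pow_right₀ hL1 (by norm_num)
    have h0 : 0 ≤ σ ^ 6 * F := by positivity
    have h1 := mul_le_mul_of_nonneg_right hL10 h0
    have e : (1024 * L ^ 26 * F) * σ ^ 6 = 1024 * (L ^ 26 * (σ ^ 6 * F)) := by ring
    rw [e] at hFσ
    linarith
  have hp4 : 512 * (L ^ 26 * (σ ^ 2 * F)) ≤ L ^ 20 * γ ^ 2 * σ ^ 6 / 4 := by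
    have hσ26 : σ ^ 2 ≤ σ ^ 6 := pow_le_pow_right₀ hσ1 (by norm_num)
    have h0 : 0 ≤ L ^ 26 * F := by positivity
    have h1 := mul_le_mul_of_nonneg_left hσ26 h0
    have e : (1024 * L ^ 26 * F) * σ ^ 6 = 1024 * (L ^ 26 * F * σ ^ 6) := by ring
    have e2 : L ^ 26 * (σ ^ 2 * F) = L ^ 26 * F * σ ^ 2 := by ring
    rw [e] at hFσ; rw [e2]
    linarith
  linarith [htot, hp1, hp2, hp3, hp4]

/-- **The propagated masses at the next scale.**  For `X ≥ σ²`,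
`64γ²X⁶ + 64X³(Vₐ + s + b(X + 11/10))² ≤ 32 (L¹⁰γ)² X⁶` with the increment bounds in the root variables. [folklore] -/
theorem propagated_le {L σ σ₀ γ γ₀ Φ ν Du r Va s bT X : ℝ} (hL : 239000000 ≤ L) (hσm : L ^ 17 ≤ σ) (hσ₀ : σ ≤ σ₀)
    (hγ₀ : 0 ≤ γ₀) (hγ : γ₀ ≤ γ) (hΦ : 0 ≤ Φ) (hν : 0 ≤ ν) (hDu : 0 ≤ Du) (hr : 1 ≤ r)
    (hVa0 : 0 ≤ Va)
    (hVa : Va ≤ L ^ 8 * (γ * σ ^ 3 + σ ^ 4 * Φ + σ ^ 2 * Du / r ^ 2) + (66 / 5) * L ^ 8 * (γ * σ + σ ^ 2 * Φ + Du / (σ * r ^ 2) + σ ^ 2 * ν))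
    (hs0 : 0 ≤ s) (hs : s ≤ L ^ 13 * (γ * σ + σ ^ 2 * Φ + Du / (σ * r ^ 2) + σ ^ 2 * ν))
    (hbT0 : 0 ≤ bT) (hbT : bT ≤ 12 * L ^ 8 * (γ * σ + σ ^ 2 * Φ + Du / (σ * r ^ 2) + σ ^ 2 * ν))
    (hfloor : L ^ 114 * (σ₀ ^ 2 * Φ ^ 2 + Φ ^ 2 + σ₀ ^ 6 * ν ^ 2 + σ₀ ^ 2 * ν ^ 2 + ν ^ 2 + Du ^ 2 / r ^ 4) ≤ γ₀ ^ 2)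
    (hX : σ ^ 2 ≤ X) :
    64 * γ ^ 2 * X ^ 6 + 64 * X ^ 3 * (Va + s + bT * (X + 11 / 10)) ^ 2 ≤ 32 * (L ^ 10 * γ) ^ 2 * X ^ 6 := by
  have hL0 : 0 ≤ L := le_trans (by norm_num) hL
  have hL1 : 1 ≤ L := le_trans (by norm_num) hL
  have hσ1 : (1 : ℝ) ≤ σ := le_trans (one_le_pow₀ hL1) hσm
  have hσ0 : 0 < σ := by linarith
  have hX64 : 64 ≤ X := by
    have h8 : (8 : ℝ) ≤ σ := le_trans (le_trans (by norm_num) (le_trans hL (le_self_pow₀ hL1 (by norm_num)))) hσm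
    nlinarith
  have hX0 : 0 < X := by linarith
  have hA := incr_value_sq_le hL hσm hσ₀ hγ₀ hγ hΦ hν hDu hr hVa0 hVa hs0 hs hfloor
  have hB := incr_slope_sq_le hL hσm hσ₀ hγ₀ hγ hr hbT0 hbT hfloor
  have hX3 : σ ^ 6 ≤ X ^ 3 := by
    have := pow_le_pow_left₀ (by positivity) hX 3
    rwa [← pow_mul] at this
  have hsq : (Va + s + bT * (X + 11 / 10)) ^ 2 ≤ 2 * (Va + s) ^ 2 + (21 / 10) * bT ^ 2 * X ^ 2 := by
    have h1 : (Va + s + bT * (X + 11 / 10)) ^ 2 ≤ 2 * (Va + s) ^ 2 + 2 * (bT * (X + 11 / 10)) ^ 2 := by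
      nlinarith only [sq_nonneg (Va + s - bT * (X + 11 / 10))]
    have h2 : (X + 11 / 10) ^ 2 ≤ (21 / 20) * X ^ 2 := by nlinarith only [hX64]
    have h3 : 2 * (bT * (X + 11 / 10)) ^ 2 ≤ (21 / 10) * bT ^ 2 * X ^ 2 := by
      have := mul_le_mul_of_nonneg_left h2 (sq_nonneg bT)
      nlinarith only [this]
    linarith
  have hL20γ : 64 * γ ^ 2 ≤ 8 * (L ^ 20 * γ ^ 2) := by
    have hL20 : (8 : ℝ) ≤ L ^ 20 := le_trans (by norm_num) (le_trans hL (le_self_pow₀ hL1 (by norm_num)))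
    nlinarith only [hL20, sq_nonneg γ]
  have hX30 : 0 ≤ X ^ 3 := by positivity
  have hX60 : 0 ≤ X ^ 6 := by positivity
  have hpartA : 128 * (Va + s) ^ 2 * X ^ 3 ≤ 8 * (L ^ 20 * γ ^ 2) * X ^ 6 := by
    have h1 : 128 * (Va + s) ^ 2 ≤ 8 * (L ^ 20 * γ ^ 2) * σ ^ 6 := by linarith [hA]
    calc 128 * (Va + s) ^ 2 * X ^ 3 ≤ 8 * (L ^ 20 * γ ^ 2) * σ ^ 6 * X ^ 3 := mul_le_mul_of_nonneg_right h1 hX30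
      _ = 8 * (L ^ 20 * γ ^ 2) * (σ ^ 6 * X ^ 3) := by ring
      _ ≤ 8 * (L ^ 20 * γ ^ 2) * (X ^ 3 * X ^ 3) :=
          mul_le_mul_of_nonneg_left (mul_le_mul_of_nonneg_right hX3 hX30) (by positivity)
      _ = 8 * (L ^ 20 * γ ^ 2) * X ^ 6 := by ring
  have hpartB : 64 * ((21 / 10) * bT ^ 2 * X ^ 2) * X ^ 3 ≤ 16 * (L ^ 20 * γ ^ 2) * X ^ 6 := by
    have h1 : 64 * ((21 / 10) * bT ^ 2) ≤ 16 * (L ^ 20 * γ ^ 2) * σ ^ 2 := by linarith [hB]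
    have hX50 : 0 ≤ X ^ 5 := by positivity
    calc 64 * ((21 / 10) * bT ^ 2 * X ^ 2) * X ^ 3 = 64 * ((21 / 10) * bT ^ 2) * X ^ 5 := by ring
      _ ≤ 16 * (L ^ 20 * γ ^ 2) * σ ^ 2 * X ^ 5 := mul_le_mul_of_nonneg_right h1 hX50
      _ = 16 * (L ^ 20 * γ ^ 2) * (σ ^ 2 * X ^ 5) := by ring
      _ ≤ 16 * (L ^ 20 * γ ^ 2) * (X * X ^ 5) :=
          mul_le_mul_of_nonneg_left (mul_le_mul_of_nonneg_right hX hX50) (by positivity)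
      _ = 16 * (L ^ 20 * γ ^ 2) * X ^ 6 := by ring
  have hmid : 64 * X ^ 3 * (Va + s + bT * (X + 11 / 10)) ^ 2 ≤ 128 * (Va + s) ^ 2 * X ^ 3 + 64 * ((21 / 10) * bT ^ 2 * X ^ 2) * X ^ 3 := by
    have := mul_le_mul_of_nonneg_left hsq (by positivity : (0 : ℝ) ≤ 64 * X ^ 3)
    linarith
  have h64 := mul_le_mul_of_nonneg_right hL20γ hX60
  calc 64 * γ ^ 2 * X ^ 6 + 64 * X ^ 3 * (Va + s + bT * (X + 11 / 10)) ^ 2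
      ≤ 8 * (L ^ 20 * γ ^ 2) * X ^ 6 + (8 * (L ^ 20 * γ ^ 2) * X ^ 6 + 16 * (L ^ 20 * γ ^ 2) * X ^ 6) := by
        linarith [hmid, hpartA, hpartB, h64]
    _ = 32 * (L ^ 10 * γ) ^ 2 * X ^ 6 := by ring

/-- **The fresh masses at the next scale** (`X ∈ [σ²/(16L²⁰), σ²]`): the envelope bound of `fresh_mass_le` is below
`32 (L¹⁰γ)² X⁶`. [folklore] -/
theorem fresh_total_le {L σ σ₀ γ γ₀ Φ ν Du r Λs K s W X : ℝ} (hL : 239000000 ≤ L) (hσm : L ^ 17 ≤ σ) (hσ₀ : σ ≤ σ₀)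
    (hγ₀ : 0 ≤ γ₀) (hγ : γ₀ ≤ γ) (hr : 1 ≤ r) (hK : 0 ≤ K)
    (hK' : K ≤ 1428 * L ^ 9 * (γ / σ + Φ + Du / (σ ^ 2 * r ^ 2) + σ ^ 2 * ν))
    (hs : 0 ≤ s) (hs' : s ≤ L ^ 13 * (γ * σ + σ ^ 2 * Φ + Du / (σ * r ^ 2) + σ ^ 2 * ν))
    (hΛ : L ^ 113 * Λs ^ 2 ≤ 1)
    (hW : W ≤ L ^ 12 * (γ ^ 2 + Λs ^ 2 * γ ^ 2 * σ ^ 12 + σ ^ 14 * Φ ^ 2 + σ ^ 8 * Du ^ 2 / r ^ 4))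
    (hfloor : L ^ 114 * (σ₀ ^ 2 * Φ ^ 2 + Φ ^ 2 + σ₀ ^ 6 * ν ^ 2 + σ₀ ^ 2 * ν ^ 2 + ν ^ 2 + Du ^ 2 / r ^ 4) ≤ γ₀ ^ 2)
    (hX : σ ^ 2 / (16 * L ^ 20) ≤ X) (hXσ : X ≤ σ ^ 2) :
    2 * (32 * X ^ 3 * (3 * (K * (X + 11 / 10) ^ 2) ^ 2 + 3 * s ^ 2)) + 2 * W ≤ 32 * (L ^ 10 * γ) ^ 2 * X ^ 6 := by
  have hL0 : 0 ≤ L := le_trans (by norm_num) hL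
  have hL1 : 1 ≤ L := le_trans (by norm_num) hL
  have hσ1 : (1 : ℝ) ≤ σ := le_trans (one_le_pow₀ hL1) hσm
  have hX1 : 64 ≤ X := by
    -- σ² ≥ L³⁴ ≥ 1024 L²⁰
    have h34 : L ^ 34 ≤ σ ^ 2 := by
      have := pow_le_pow_left₀ (by positivity) hσm 2
      rwa [← pow_mul] at this
    have h14 : (1024 : ℝ) ≤ L ^ 14 := le_trans (by norm_num) (le_trans hL (le_self_pow₀ hL1 (by norm_num)))
    have h2 : 1024 * L ^ 20 ≤ σ ^ 2 := by
      calc 1024 * L ^ 20 ≤ L ^ 14 * L ^ 20 := mul_le_mul_of_nonneg_right h14 (by positivity)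
        _ = L ^ 34 := by ring
        _ ≤ σ ^ 2 := h34
    have h3 : (64 : ℝ) ≤ σ ^ 2 / (16 * L ^ 20) := by
      rw [le_div_iff₀ (by positivity)]; linarith
    linarith
  have h1 := fresh_taylor_le (Φ := Φ) (ν := ν) (Du := Du) hL hσ1 hσ₀ hγ₀ hγ hr hK hK' hfloor hX1 hXσ
  have h2 := fresh_shift_le (Φ := Φ) (ν := ν) (Du := Du) hL hσm hσ₀ hγ₀ hγ hr hs hs' hfloor hX
  have h3 := fresh_w_le (Φ := Φ) (ν := ν) (Du := Du) hL hσm hσ₀ hγ₀ hγ hr hΛ hW hfloor hX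
  have h0 : 0 ≤ 8 * (L ^ 10 * γ) ^ 2 * X ^ 6 := by positivity
  have e : 2 * (32 * X ^ 3 * (3 * (K * (X + 11 / 10) ^ 2) ^ 2 + 3 * s ^ 2)) + 2 * W =
      64 * X ^ 3 * (3 * (K * (X + 11 / 10) ^ 2) ^ 2) + 192 * s ^ 2 * X ^ 3 + 2 * W := by ring
  rw [e]; linarith

/-! ## The budget potentials across one step (`σ' = σ/(4L¹⁰)`, `γ' = L¹⁰γ`) -/

/-- **The slope-type potential propagates**: with `U' = U + 𝔖₁`,
`U' + 2γ'σ' + 2σ'²(Φ+ν) ≤ U⋆ + 2ϑ Du/(σ' r²)`. [folklore] -/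
theorem potU_step {L σ γ Φ ν Du r U Ustar : ℝ} (hL : 239000000 ≤ L) (hσ : 8 ≤ σ) (hγ : 0 ≤ γ) (hΦ : 0 ≤ Φ)
    (hν : 0 ≤ ν) (hDu : 0 ≤ Du) (hr : 0 < r)
    (h : U + 2 * (γ * σ) + 2 * (σ ^ 2 * (Φ + ν)) ≤ Ustar + 2 * (1 / (4 * L ^ 10)) * (Du / (σ * r ^ 2))) :
    (U + (γ * σ + σ ^ 2 * Φ + Du / (σ * r ^ 2) + σ ^ 2 * ν)) + 2 * ((L ^ 10 * γ) * (σ / (4 * L ^ 10))) +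
        2 * ((σ / (4 * L ^ 10)) ^ 2 * (Φ + ν)) ≤
      Ustar + 2 * (1 / (4 * L ^ 10)) * (Du / ((σ / (4 * L ^ 10)) * r ^ 2)) := by
  have hL0 : 0 < L := lt_of_lt_of_le (by norm_num) hL
  have hL1 : 1 ≤ L := le_trans (by norm_num) hL
  have hσ0 : 0 < σ := by linarith
  have hL10 : 0 < L ^ 10 := by positivity
  have e1 : (L ^ 10 * γ) * (σ / (4 * L ^ 10)) = (γ * σ) / 4 := by field_simp
  have e2 : (σ / (4 * L ^ 10)) ^ 2 * (Φ + ν) = (σ ^ 2 * (Φ + ν)) / (16 * L ^ 20) := by field_simp; ring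
  have e3 : 2 * (1 / (4 * L ^ 10)) * (Du / ((σ / (4 * L ^ 10)) * r ^ 2)) = 2 * (Du / (σ * r ^ 2)) := by field_simp
  rw [e1, e2, e3]
  have hγσ : 0 ≤ γ * σ := by positivity
  have hΦν : 0 ≤ σ ^ 2 * (Φ + ν) := by positivity
  have hD : 0 ≤ Du / (σ * r ^ 2) := by positivity
  have h16 : (σ ^ 2 * (Φ + ν)) / (16 * L ^ 20) ≤ σ ^ 2 * (Φ + ν) / 2 := by
    rw [div_le_div_iff₀ (by positivity) (by norm_num)]
    have : (2 : ℝ) ≤ 16 * L ^ 20 := by linarith [one_le_pow₀ (M₀ := ℝ) (n := 20) hL1]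
    nlinarith [this, hΦν]
  have hϑ : 2 * (1 / (4 * L ^ 10)) * (Du / (σ * r ^ 2)) ≤ Du / (σ * r ^ 2) := by
    have : 2 * (1 / (4 * L ^ 10)) ≤ 1 := by
      rw [show 2 * (1 / (4 * L ^ 10)) = 1 / (2 * L ^ 10) by ring, div_le_one (by positivity)]
      nlinarith [one_le_pow₀ (n := 10) hL1]
    exact (mul_le_mul_of_nonneg_right this hD).trans (by rw [one_mul])
  nlinarith [h, h16, hϑ, hγσ, hΦν, hD]

/-- **The value-type potential propagates**: with `Vb' = Vb + 𝔙`, `Vb' + 2𝔙' ≤ V⋆`. [folklore] -/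
theorem potV_step {L σ γ Φ Du r Vb Vstar : ℝ} (hL : 239000000 ≤ L) (hσ : 0 ≤ σ) (hγ : 0 ≤ γ) (hΦ : 0 ≤ Φ)
    (hDu : 0 ≤ Du) (hr : 0 < r)
    (h : Vb + 2 * (γ * σ ^ 3 + σ ^ 4 * Φ + σ ^ 2 * Du / r ^ 2) ≤ Vstar) :
    (Vb + (γ * σ ^ 3 + σ ^ 4 * Φ + σ ^ 2 * Du / r ^ 2)) +
        2 * ((L ^ 10 * γ) * (σ / (4 * L ^ 10)) ^ 3 + (σ / (4 * L ^ 10)) ^ 4 * Φ + (σ / (4 * L ^ 10)) ^ 2 * Du / r ^ 2) ≤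
      Vstar := by
  have hL0 : 0 < L := lt_of_lt_of_le (by norm_num) hL
  have hL1 : 1 ≤ L := le_trans (by norm_num) hL
  have e : (L ^ 10 * γ) * (σ / (4 * L ^ 10)) ^ 3 + (σ / (4 * L ^ 10)) ^ 4 * Φ + (σ / (4 * L ^ 10)) ^ 2 * Du / r ^ 2 =
      (γ * σ ^ 3) / (64 * L ^ 20) + (σ ^ 4 * Φ) / (256 * L ^ 40) + (σ ^ 2 * Du / r ^ 2) / (16 * L ^ 20) := by
    field_simp; ring
  rw [e]
  have h1 : 0 ≤ γ * σ ^ 3 := by positivity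
  have h2 : 0 ≤ σ ^ 4 * Φ := by positivity
  have h3 : 0 ≤ σ ^ 2 * Du / r ^ 2 := by positivity
  have hL20 : (4 : ℝ) ≤ 64 * L ^ 20 := by linarith [one_le_pow₀ (M₀ := ℝ) (n := 20) hL1]
  have hL40 : (4 : ℝ) ≤ 256 * L ^ 40 := by linarith [one_le_pow₀ (M₀ := ℝ) (n := 40) hL1]
  have hL20' : (4 : ℝ) ≤ 16 * L ^ 20 := by linarith [one_le_pow₀ (M₀ := ℝ) (n := 20) hL1]
  have d1 : (γ * σ ^ 3) / (64 * L ^ 20) ≤ (γ * σ ^ 3) / 4 := div_le_div_of_nonneg_left h1 (by norm_num) hL20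
  have d2 : (σ ^ 4 * Φ) / (256 * L ^ 40) ≤ (σ ^ 4 * Φ) / 4 := div_le_div_of_nonneg_left h2 (by norm_num) hL40
  have d3 : (σ ^ 2 * Du / r ^ 2) / (16 * L ^ 20) ≤ (σ ^ 2 * Du / r ^ 2) / 4 := div_le_div_of_nonneg_left h3 (by norm_num) hL20'
  linarith

/-- **The slope scale of the current step from the potential**: `𝔖₁ ≤ U⋆/2 + Du/(4r²)`. [folklore] -/
theorem sAgg_le_of_pot {L σ γ Φ ν Du r U Ustar : ℝ} (hL : 239000000 ≤ L) (hσ : 8 ≤ σ) (hDu : 0 ≤ Du) (hr : 0 < r)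
    (hU : 0 ≤ U)
    (h : U + 2 * (γ * σ) + 2 * (σ ^ 2 * (Φ + ν)) ≤ Ustar + 2 * (1 / (4 * L ^ 10)) * (Du / (σ * r ^ 2))) :
    γ * σ + σ ^ 2 * Φ + Du / (σ * r ^ 2) + σ ^ 2 * ν ≤ Ustar / 2 + Du / (4 * r ^ 2) := by
  have hL1 : 1 ≤ L := le_trans (by norm_num) hL
  have hσ0 : 0 < σ := by linarith
  have hD : 0 ≤ Du / (σ * r ^ 2) := by positivity
  have hϑ : 2 * (1 / (4 * L ^ 10)) * (Du / (σ * r ^ 2)) ≤ Du / (σ * r ^ 2) := by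
    have : 2 * (1 / (4 * L ^ 10)) ≤ 1 := by
      rw [show 2 * (1 / (4 * L ^ 10)) = 1 / (2 * L ^ 10) by ring, div_le_one (by positivity)]
      nlinarith [one_le_pow₀ (n := 10) hL1]
    exact (mul_le_mul_of_nonneg_right this hD).trans (by rw [one_mul])
  have h8 : Du / (σ * r ^ 2) ≤ Du / (8 * r ^ 2) :=
    div_le_div_of_nonneg_left hDu (by positivity) (by nlinarith [pow_pos hr 2])
  have e : Du / (8 * r ^ 2) = (Du / (4 * r ^ 2)) / 2 := by field_simp; ring
  nlinarith [h, hϑ, h8, e, hU]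

end Summit.AtomisticToContinuum.Crystallization.Theorems.ExcessDecayLiouville
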